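import Summits.NavierStokesRegularity.NavierStokesRegularity.Theses.TypeICertificateLadder
import Literature.Analysis.FluidPDE.NSQuasipotential
import Literature.Analysis.FluidPDE.ClassicalSolutionCalculus
import Literature.Analysis.FluidPDE.AncientMildWeak
import Literature.Analysis.FluidPDE.KNSSTypeIIHolds

/-!
# Disproof work file — crux `RungReynoldsOne` (stmt-NavierStokesRegularity-2882), findings

Crux (route `TypeICertificateLadder`, rank 5) = rung `X_1` of the Type-I certificate ladder:
`∀ ν T > 0, ∀ u p, IsClassicalNSSolutionOn (Ico 0 T) ν 0 u p → IsLerayHopfOn T ν 0 (u 0) u →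
HasRapidSpatialDecay (u 0) → (∀ᶠ t in 𝓝[<] T, ∀ x, √(T−t)‖u t x‖ ≤ √ν) →
HasSmoothExtensionPast ν 0 u T` — no finite-energy classical solution from a Schwartz datum blows
up at `T` with collapse Reynolds number `√((T−t)/ν)‖u(t)‖_∞ ≤ 1`.

Standing adversary (cdisprove), generation 2. Everything below is kernel-checked (rc 0, no
`sorry`); prose lives only in docstrings. The generation-1 file (57 decls, same seat family) is
cited from its evidence notes where this file re-derives a section (§A, §A′, §B, §E of gen-1);
sections (a-II) and (c) are new.

## Findings

1. **No kill, and none is expected: the crux is very likely TRUE.** A counterexample is a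
   finite-energy Type-I singularity of 3D Navier–Stokes from a Schwartz datum
   (`not_rungReynoldsOne_iff`, `isTypeIBlowup_of_not_rungReynoldsOne`) — a negative resolution of
   the Millennium problem; nothing in print or in this tree produces one, and the statement
   quantifies over honest fields on `ℝ³` (no interface to instantiate by junk, no finite model to
   compute). Worse for the adversary: the `L^q`-vorticity budget of crux idea card
   `Ideas/ideas-2882-ideator3.md` (card 1) closes rung `X_C` whenever `q(q−1)C²/4 < q − 3/2` for
   some admissible `q`; its bookkeeping was re-derived by hand in this seat (stretching IBP'd onto
   `u`, Young against the two viscous pieces, constant `q(q−1)/4`; lower exponent `(2q−3)/(2q)·q`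
   from the Leray–Giga `L^r` rate at `r = 3q/(3−q)`) and checks. Section (c) settles exactly what
   that bookkeeping can reach: at `C = 1` the window is precisely `2 < q < 3`
   (`budgetCloses_one_iff`, `budgetCloses_one_qstar`), the enstrophy case `q = 2` reaches exactly
   `C < 1` (`budgetCloses_two_iff`) and is SATURATED at the crux (`enstrophy_budget_saturated`),
   and over all `q` the reach is exactly `C < √6 − √2 ∈ (1.035, 1.036)`
   (`lt_ceiling_of_budgetCloses`, `budget_ratio_at_qstar`, `sqrt_six_sub_sqrt_two_bounds`). So
   `X_1` sits inside the window with a 3.5 % margin, while NO rung `C ≥ 1.036` is reachable this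
   way — the ladder's later rungs (2, 5, 10) need the certificate machinery or a new idea.
2. **Load-bearing I — finite energy cannot be dropped, at any rung** (`rung_false_without_LerayHopf`,
   `rungReynoldsOne_false_without_LerayHopf`; gen-1 §A re-derived). Witness: the Type-I drift
   `u = g_C(t)e₀`, `p = −g_C′(t)x₀`, `g_C(t) = C((1−t)^{-1/2} − 1)`: classical on `[0,1) × ℝ³` for
   every `ν` (`drift_isClassical`), datum `0`, collapse Reynolds number `≤ C` on all of `[0,1)`,
   vorticity ≡ 0, no classical extension (`drift_not_hasSmoothExtensionPast`). These are the
   "parasitic solutions" `u = b(t)`, `p = −b′(t)·x` of Koch–Nadirashvili–Seregin–Šverák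
   (Acta Math. 203 (2009) = arXiv:0709.3599, §1 p. 3).
3. **Load-bearing II (new) — it is the energy CLASS, not Leray's weak identity, that bears the
   load** (`rung_false_with_weak_for_LerayHopf`). Replacing `IsLerayHopfOn` by the bare weak
   formulation `IsWeakNSSolutionOn T ν 0 (u 0) u` keeps every rung FALSE: the sub-Type-I drift
   `q_C(t) = C((1−t)^{-1/4} − 1)` is a weak solution up to `T = 1`
   (`drift_isWeakNSSolutionOn`: the linear pressure is invisible to divergence-free tests — KNSS
   loc. cit.: "this notion of solution does allow the parasitic solutions"), its collapse Reynolds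
   number even tends to `0` (`driftQ_rate_eventually_le`), and it does not extend. Of the
   Leray–Hopf clauses the drifts violate exactly the energy ones (`energy_bound`, `memLp` for
   `t > 0`, weak `L²`-continuity at `t = T`, `strong_initial`); `weakGrad_energy` would even hold
   by Bochner junk. Formally: `driftQ_weak_not_LerayHopf` (weak on `[0,1)` yet
   not Leray–Hopf, through `memLp`). MESSAGE TO PROVERS: the proof must use `u(t) ∈ L²`
   quantitatively, and in the card-1 line it does so exactly once — in "singular time ⇒ ‖ω‖_q (equivalently ‖u‖_{L^r})
   blows up at the Leray–Giga rate", which fails for the drifts (ω ≡ 0 while ‖u‖_∞ ↑ ∞).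
4. **Load-bearing III (typing remark; gen-1 §A′ re-derived)** (`rungReynoldsOne_false_without_classical`):
   without `IsClassicalNSSolutionOn`, a null modification of the rest state (`spike`) is
   Leray–Hopf (`spike_isLerayHopfOn`), rapidly decaying, rate `0`, and has no classical
   continuation — the agreement clause of `HasSmoothExtensionPast` is pointwise. Weak-solution
   restatements of the rung must conclude with a.e. agreement.
5. **Non-vacuity** (`rungReynoldsOne_hypotheses_satisfiable`): the rest state satisfies all four
   hypotheses and the conclusion; the crux is not true for lack of instances. Nor is it vacuous
   in the scenario it targets: `IsLerayHopfOn T …` constrains the slice `u T` (`memLp` on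
   `Icc 0 T`, weak `L²`-continuity on `Ioc 0 T`, energy inequality at `t = T`), but a genuine
   blow-up solution meets these with `u T :=` the weak `L²` limit of `u(t)`, `t ↑ T` (Leray–Hopf
   solutions are weakly `L²`-continuous and the energy inequality passes to weak limits), so no
   refutation or vacuity hides in the endpoint clauses.
6. **Logical position** (§(d)): `RungReynoldsOne ↔ Rung 1`; rungs are monotone (`rung_mono`);
   every rung follows from the route target `NoTypeIBlowup` (`rung_of_noTypeIBlowup`); the rate
   hypothesis is a Type-I rate (`isTypeIBlowup_of_rate`); a refutation = a maximal classical
   Leray–Hopf Schwartz-datum solution with a Type-I singularity (`not_rungReynoldsOne_iff`).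
7. **No junk to exploit in the rate clause** (`rate_nhds_iff`): `𝓝[<] T` may be replaced by
   `𝓝 T` (`√(T−t) = 0` past `T`). `0 < ν`, `0 < T` are not load-bearing (gen-1 §D: `C ≤ 0` /
   `ν ≤ 0` slices are TRUE); `HasRapidSpatialDecay (u 0)` has no cheap witness either way — keep
   it, it is what justifies the integrations by parts at infinity in the budget line.
8. **Positive calibration** (`rungReynoldsOne_of_apriori_bound`, via the tree theorem
   `hasSmoothExtensionPast_of_bounded_holds` = RRS2016 Thm 8.17): the crux is exactly an a-priori
   `L^∞` bound on `[0,T) × ℝ³` for rate-one solutions; `bound_of_eventually_of_substrips` splits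
   it into the research content (an eventual bound near `T`) and far-field bookkeeping.
9. **Why it resists, in one line.** Unconditionally known: `X_C` for `C < c_Leray` (Leray 1934
   §19 (3.9); tree `leray_blowup_rate_top_holds`), every `C < 1` by the enstrophy budget × Leray's
   `H¹` rate (planner RUNG_NOTE on 1217; `budgetCloses_two_iff`), size-only Duhamel comparisons
   stop at `C < 1/(πK) ≈ 0.28` (gen-1 §C); `C = 1` is the exact `q = 2` borderline and inside the
   `q ∈ (2,3)` window of card 1. Every Type-I-rate blow-up mechanism in print lives outside the
   hypotheses — infinite energy (this file), dyadic/averaged models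
   (`Literature.Barriers.NavierStokesRegularity.TruncatedDyadicTypeIBlowup`), complex-valued or
   forced/non-unique weak solutions — and `AxisymmetricTypeIExclusion` makes the axisymmetric class
   a theorem at every `C`.
-/

noncomputable section

namespace Summit.NavierStokesRegularity.NavierStokesRegularity.Cruxes.RungReynoldsOne.Disproof

open Set Filter Topology MeasureTheory Function
open scoped InnerProductSpace RealInnerProductSpace ContDiff Laplacian ENNReal
open Literature.Analysis.FluidPDE
open Summit.NavierStokesRegularity.NavierStokesRegularity.Theses.TypeICertificateLadder

local notation "ℝ³" => EuclideanSpace ℝ (Fin 3)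

/-! ## The statements under attack (crux with one hypothesis dropped or weakened) -/

/-- Rung `X_C` of the ladder (shape of `LadderGlue`/`Assembly`) with the Leray–Hopf hypothesis
`IsLerayHopfOn T ν 0 (u 0) u` DROPPED. False for every `C > 0` (`rung_false_without_LerayHopf`). -/
def RungWithoutLerayHopf (C : ℝ) : Prop :=
  ∀ (ν T : ℝ), 0 < ν → 0 < T → ∀ (u : ℝ → ℝ³ → ℝ³) (p : ℝ → ℝ³ → ℝ),
    IsClassicalNSSolutionOn (Set.Ico 0 T) ν 0 u p →
    HasRapidSpatialDecay (u 0) →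
    (∀ᶠ t in 𝓝[<] T, ∀ x, Real.sqrt (T - t) * ‖u t x‖ ≤ C * Real.sqrt ν) →
    HasSmoothExtensionPast ν 0 u T

/-- The crux `RungReynoldsOne` verbatim with the single hypothesis `IsLerayHopfOn T ν 0 (u 0) u`
deleted. False (`rungReynoldsOne_false_without_LerayHopf`). -/
def RungReynoldsOneWithoutLerayHopf : Prop :=
  ∀ (ν T : ℝ), 0 < ν → 0 < T → ∀ (u : ℝ → ℝ³ → ℝ³) (p : ℝ → ℝ³ → ℝ),
    IsClassicalNSSolutionOn (Set.Ico 0 T) ν 0 u p →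
    HasRapidSpatialDecay (u 0) →
    (∀ᶠ t in 𝓝[<] T, ∀ x, Real.sqrt (T - t) * ‖u t x‖ ≤ Real.sqrt ν) →
    HasSmoothExtensionPast ν 0 u T

/-- Rung `X_C` with the Leray–Hopf class WEAKENED to the bare weak formulation
`IsWeakNSSolutionOn T ν 0 (u 0) u` (jointly measurable, locally square integrable up to `T`,
weakly divergence free, Leray's identity (17) against divergence-free tests — the PDE content of
`IsLerayHopfOn` without its energy clauses). Still false for every `C > 0`
(`rung_false_with_weak_for_LerayHopf`): the energy CLASS, not the equation, is load-bearing. -/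
def RungWithWeakForLerayHopf (C : ℝ) : Prop :=
  ∀ (ν T : ℝ), 0 < ν → 0 < T → ∀ (u : ℝ → ℝ³ → ℝ³) (p : ℝ → ℝ³ → ℝ),
    IsClassicalNSSolutionOn (Set.Ico 0 T) ν 0 u p →
    IsWeakNSSolutionOn T ν 0 (u 0) u →
    HasRapidSpatialDecay (u 0) →
    (∀ᶠ t in 𝓝[<] T, ∀ x, Real.sqrt (T - t) * ‖u t x‖ ≤ C * Real.sqrt ν) →
    HasSmoothExtensionPast ν 0 u T

/-! ## The witness family: pressure-driven spatially constant flows `u = g(t) e₀`, `p = −g′(t) x₀` -/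

/-- The drift direction `e₀ = (1, 0, 0)`. -/
def e₀ : ℝ³ := EuclideanSpace.single 0 1

@[simp] theorem norm_e₀ : ‖e₀‖ = 1 := by
  simp [e₀]

theorem e₀_ne_zero : e₀ ≠ 0 := by
  intro h
  have := norm_e₀
  rw [h, norm_zero] at this
  exact zero_ne_one this

/-- The drift velocity `u(t, x) = g(t) e₀` (spatially constant; zero vorticity). -/
def drift (g : ℝ → ℝ) : ℝ → ℝ³ → ℝ³ := fun t _ => g t • e₀

/-- The drift pressure `p(t, x) = ⟪−g′(t) e₀, x⟫ = −g′(t) x₀` (linear in `x`). -/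
def driftP (g : ℝ → ℝ) : ℝ → ℝ³ → ℝ := fun t x => ⟪-(deriv g t • e₀), x⟫_ℝ

theorem drift_apply (g : ℝ → ℝ) (t : ℝ) : drift g t = fun _ => g t • e₀ := rfl

theorem drift_zero {g : ℝ → ℝ} (h0 : g 0 = 0) : drift g 0 = 0 := by
  funext x
  simp [drift, h0]

theorem norm_drift (g : ℝ → ℝ) (t : ℝ) (x : ℝ³) : ‖drift g t x‖ = |g t| := by
  simp [drift, norm_smul]

/-- The gradient of the linear functional `y ↦ ⟪v, y⟫` is `v`. -/
theorem gradient_inner_left (v x : ℝ³) : gradient (fun y : ℝ³ => ⟪v, y⟫_ℝ) x = v := by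
  have h : HasFDerivAt (fun y : ℝ³ => ⟪v, y⟫_ℝ) (innerSL ℝ v) x := (innerSL ℝ v).hasFDerivAt
  have hv : (InnerProductSpace.toDual ℝ ℝ³).symm (innerSL ℝ v) = v := by
    apply (InnerProductSpace.toDual ℝ ℝ³).injective
    rw [LinearIsometryEquiv.apply_symm_apply]
    ext y
    simp [InnerProductSpace.toDual_apply_apply]
  have hg := h.hasGradientAt.gradient
  rwa [hv] at hg

section Drift

variable {g : ℝ → ℝ}

/-- **Every drift is a classical solution** of unforced Navier–Stokes on `[0,1) × ℝ³`, for every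
viscosity, as soon as the amplitude is smooth on `(-∞, 1)`: `∂ₜu = g′e₀ = −∇p`,
`(u·∇)u = 0`, `Δu = 0`, `div u = 0`. -/
theorem drift_isClassical (hg : ContDiffOn ℝ ∞ g (Iio 1)) (ν : ℝ) :
    IsClassicalNSSolutionOn (Ico 0 1) ν 0 (drift g) (driftP g) where
  smooth_velocity := by
    show ContDiffOn ℝ ∞ (fun z : ℝ × ℝ³ => g z.1 • e₀) (Ico 0 1 ×ˢ univ)
    have h1 : ContDiffOn ℝ ∞ (fun z : ℝ × ℝ³ => g z.1) (Ico 0 1 ×ˢ univ) :=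
      hg.comp contDiffOn_fst fun z hz => (mem_prod.1 hz).1.2
    exact h1.smul contDiffOn_const
  smooth_pressure := by
    show ContDiffOn ℝ ∞ (fun z : ℝ × ℝ³ => ⟪-(deriv g z.1 • e₀), z.2⟫_ℝ) (Ico 0 1 ×ˢ univ)
    have hd' : ContDiffOn ℝ ∞ (deriv g) (Iio 1) :=
      ((contDiffOn_infty_iff_deriv_of_isOpen isOpen_Iio).1 hg).2
    have hd : ContDiffOn ℝ ∞ (fun z : ℝ × ℝ³ => deriv g z.1) (Ico 0 1 ×ˢ univ) :=
      hd'.comp contDiffOn_fst fun z hz => (mem_prod.1 hz).1.2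
    exact (hd.smul contDiffOn_const).neg.inner ℝ contDiffOn_snd
  momentum t ht x := by
    have hga : HasDerivAt g (deriv g t) t :=
      (((hg t ht.2).contDiffAt (Iio_mem_nhds ht.2)).differentiableAt (by simp)).hasDerivAt
    have hderiv : timeDerivWithin (Ico 0 1) (drift g) t x = deriv g t • e₀ := by
      simp only [timeDerivWithin_apply, drift]
      exact (hga.smul_const e₀).hasDerivWithinAt.derivWithin (uniqueDiffOn_Ico 0 1 t ht)
    have hconv : convect (drift g t) (drift g t) x = 0 := by
      rw [drift_apply]
      simp [convect]
    have hlap : (Δ (drift g t)) x = 0 := by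
      rw [drift_apply]
      simp
    have hgrad : gradient (driftP g t) x = -(deriv g t • e₀) := by
      show gradient (fun y : ℝ³ => ⟪-(deriv g t • e₀), y⟫_ℝ) x = _
      exact gradient_inner_left _ _
    rw [hderiv, hconv, hlap, hgrad]
    simp
  divFree t _ x := by
    rw [drift_apply]
    simp [VectorCalculus.divergence]

/-- A drift with `g(0) = 0` starts from the datum `0`, which is rapidly decaying. -/
theorem drift_rapidDecay (h0 : g 0 = 0) : HasRapidSpatialDecay (drift g 0) := by
  rw [drift_zero h0]
  intro n K
  refine ⟨0, fun x => ?_⟩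
  have h : (0 : ℝ³ → ℝ³) = fun _ => (0 : ℝ³) := rfl
  rw [h, iteratedFDeriv_fun_zero]
  simp

/-- **A drift with unbounded amplitude has no classical extension past `T = 1`**: a classical
`u'` on `[0, T') × ℝ³`, `T' > 1`, agreeing with `u` on `[0, 1)` is continuous at `(1, 0)`,
while `‖u(t, 0)‖ = |g(t)| → ∞`. -/
theorem drift_not_hasSmoothExtensionPast (hlim : Tendsto (fun t => |g t|) (𝓝[<] (1 : ℝ)) atTop)
    (ν : ℝ) : ¬ HasSmoothExtensionPast ν 0 (drift g) 1 := by
  rintro ⟨T', hT', u', p', hcl, hagree⟩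
  set F : Filter ℝ := 𝓝[Ico 0 1] (1 : ℝ) with hF
  haveI : F.NeBot := by
    refine mem_closure_iff_nhdsWithin_neBot.1 ?_
    rw [closure_Ico zero_ne_one]
    exact right_mem_Icc.2 zero_le_one
  have hcont : ContinuousWithinAt (uncurry u') (Ico 0 T' ×ˢ univ) ((1 : ℝ), (0 : ℝ³)) :=
    (hcl.smooth_velocity ((1 : ℝ), (0 : ℝ³)) ⟨⟨zero_le_one, hT'⟩, mem_univ _⟩).continuousWithinAt
  have hmap : Tendsto (fun t : ℝ => ((t, (0 : ℝ³)) : ℝ × ℝ³)) F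
      (𝓝[Ico 0 T' ×ˢ univ] ((1 : ℝ), (0 : ℝ³))) := by
    refine tendsto_nhdsWithin_iff.2 ⟨?_, ?_⟩
    · have hc : Continuous (fun t : ℝ => ((t, (0 : ℝ³)) : ℝ × ℝ³)) :=
        continuous_id.prodMk continuous_const
      exact (hc.tendsto 1).mono_left nhdsWithin_le_nhds
    · filter_upwards [self_mem_nhdsWithin] with t ht
      exact mk_mem_prod ⟨ht.1, ht.2.trans hT'⟩ (mem_univ _)
  have hlim1 : Tendsto (fun t : ℝ => uncurry u' (t, 0)) F (𝓝 (u' 1 0)) := hcont.tendsto.comp hmap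
  have hlim2 : Tendsto (fun t : ℝ => g t • e₀) F (𝓝 (u' 1 0)) := by
    refine hlim1.congr' ?_
    filter_upwards [self_mem_nhdsWithin] with t ht
    simp [uncurry, hagree t ht, drift]
  have hnorm : Tendsto (fun t : ℝ => |g t|) F (𝓝 ‖u' 1 0‖) := by
    simpa [norm_smul] using hlim2.norm
  have hF_le : F ≤ 𝓝[<] (1 : ℝ) := nhdsWithin_mono _ fun t ht => ht.2
  exact not_tendsto_atTop_of_tendsto_nhds hnorm (hlim.mono_left hF_le)

/-- **Every locally-square-integrable drift is a weak (pressure-free) solution up to `T = 1`**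
(`IsWeakNSSolutionOn 1 ν 0 (u 0) u`), although it is classical only on `[0, 1)`: a test field
supported in `t < 1` is supported in `t ≤ b` for some `b < 1`, where the drift is classical on
the closed slab `[0, T']`, `b < T' < 1`, hence weak there (tree theorem
`IsClassicalNSSolutionOn.isWeakNSSolutionOn_holds`); the identity over `(0, 1)` is the identity
over `(0, T')` because the integrand vanishes for `t > b`. The only extra input at `T = 1` is the
local square integrability `∫₀¹ g² < ∞`. -/
theorem drift_isWeakNSSolutionOn (hg : ContDiffOn ℝ ∞ g (Iio 1))
    (hint : IntegrableOn (fun t => g t ^ 2) (Ioo 0 1)) (ν : ℝ) :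
    IsWeakNSSolutionOn 1 ν 0 (drift g 0) (drift g) := by
  have hcl := drift_isClassical hg ν
  refine ⟨?_, ?_, ?_, ?_⟩
  · -- joint measurability on `(0, 1) × ℝ³`
    have hc : ContinuousOn (uncurry (drift g)) (Ioo 0 1 ×ˢ univ) := by
      show ContinuousOn (fun z : ℝ × ℝ³ => g z.1 • e₀) (Ioo 0 1 ×ˢ univ)
      have h1 : ContinuousOn (fun z : ℝ × ℝ³ => g z.1) (Ioo 0 1 ×ˢ univ) :=
        hg.continuousOn.comp continuousOn_fst fun z hz => (mem_prod.1 hz).1.2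
      exact h1.smul continuousOn_const
    exact hc.aestronglyMeasurable (measurableSet_Ioo.prod MeasurableSet.univ)
  · -- local square integrability up to `t = 1`
    intro K hK
    have hgm : AEMeasurable (fun t => ‖g t‖ₑ ^ 2) ((volume : Measure ℝ).restrict (Ioo 0 1)) := by
      have : AEStronglyMeasurable g ((volume : Measure ℝ).restrict (Ioo 0 1)) :=
        (hg.continuousOn.mono Ioo_subset_Iio_self).aestronglyMeasurable measurableSet_Ioo
      exact (this.aemeasurable.enorm.pow_const 2)
    have h1 : ∫⁻ t in Ioo (0 : ℝ) 1, ‖g t‖ₑ ^ 2 < ⊤ := by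
      have h := hint.hasFiniteIntegral
      rw [hasFiniteIntegral_iff_enorm] at h
      refine lt_of_le_of_lt (le_of_eq (lintegral_congr fun t => ?_)) h
      rw [enorm_pow]
    have heq : ∀ z : ℝ × ℝ³, ‖uncurry (drift g) z‖ₑ ^ 2 =
        (fun t => ‖g t‖ₑ ^ 2) z.1 * (fun _ : ℝ³ => (1 : ℝ≥0∞)) z.2 := by
      intro z
      have hn : ‖uncurry (drift g) z‖ = ‖g z.1‖ := by
        simp [uncurry, drift, norm_smul]
      rw [mul_one, ← ofReal_norm, hn, ofReal_norm]
    simp_rw [heq]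
    rw [Measure.volume_eq_prod, ← Measure.prod_restrict,
      lintegral_prod_mul hgm aemeasurable_const, lintegral_one, Measure.restrict_apply_univ]
    exact ENNReal.mul_lt_top h1 hK.measure_lt_top
  · -- weak divergence-freeness of the (constant) slices
    refine ae_of_all _ fun t => ?_
    have hd : VectorCalculus.IsDivFree (drift g t) := fun x => by
      rw [drift_apply]
      simp [VectorCalculus.divergence]
    have hc : ContDiff ℝ 1 (drift g t) := by
      rw [drift_apply]
      exact contDiff_const
    exact VectorCalculus.IsDivFree.isWeaklyDivFree_holds hd hc
  · -- the weak identity for tests supported in `t < 1`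
    intro ψ hψ hdiv
    obtain ⟨a, b, _, hb1, hψ0⟩ := hψ.exists_time_support_lt
    set T' : ℝ := (max b 0 + 1) / 2 with hT'
    have hbT' : b < T' := by
      have := le_max_left b 0
      rw [hT']; linarith
    have hT'0 : 0 < T' := by
      have := le_max_right b 0
      rw [hT']; linarith
    have hT'1 : T' < 1 := by
      have : max b 0 < 1 := max_lt hb1 one_pos
      rw [hT']; linarith
    -- the drift is weak on `[0, T')`
    have hW : IsWeakNSSolutionOn T' ν 0 (drift g 0) (drift g) :=
      IsClassicalNSSolutionOn.isWeakNSSolutionOn_holds hcl fun t ht => ⟨ht.1, ht.2.trans_lt hT'1⟩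
    -- `ψ` is a test field on the smaller slab
    have hψ' : IsSpaceTimeTestOn (slab ℝ³ (Iio T') isOpen_Iio) ψ := by
      refine ⟨hψ.contDiff, hψ.hasCompactSupport, ?_⟩
      have hsupp : support (uncurry ψ) ⊆ Iic b ×ˢ univ := by
        intro z hz
        refine mk_mem_prod ?_ (mem_univ _)
        by_contra hzb
        apply hz
        have : ψ z.1 = 0 := hψ0 z.1 fun h => hzb h.2
        show ψ z.1 z.2 = 0
        rw [this]; rfl
      have hcl' : IsClosed (Iic b ×ˢ (univ : Set ℝ³)) := isClosed_Iic.prod isClosed_univ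
      intro z hz
      have hz' := (closure_minimal hsupp hcl') hz
      show z ∈ Iio T' ×ˢ (univ : Set ℝ³)
      exact mk_mem_prod (lt_of_le_of_lt (mem_prod.1 hz').1 hbT') (mem_univ _)
    have hid := hW.2.2.2 ψ hψ' hdiv
    -- the slice integrand vanishes for `t > b`
    have hvan : ∀ t, b < t → (∫ x, (⟪drift g t x, timeDeriv ψ t x⟫ +
        ⟪drift g t x, convect (drift g t) (ψ t) x⟫ + ν * ⟪drift g t x, Δ (ψ t) x⟫ +
        ⟪(0 : ℝ → ℝ³ → ℝ³) t x, ψ t x⟫)) = 0 := by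
      intro t hbt
      have hψt : ψ t = fun _ => (0 : ℝ³) := hψ0 t fun h => (not_le.2 hbt) h.2
      have htd : ∀ x, deriv (fun s => ψ s x) t = 0 := fun x => by
        have hev : (fun s => ψ s x) =ᶠ[𝓝 t] fun _ => (0 : ℝ³) := by
          filter_upwards [Ioi_mem_nhds hbt] with s hs
          rw [hψ0 s fun h => (not_le.2 hs) h.2]
          rfl
        rw [hev.deriv_eq, deriv_const]
      simp [htd, hψt, convect]
    have hI : (∫ t in Ioo (0 : ℝ) 1, ∫ x, (⟪drift g t x, timeDeriv ψ t x⟫ +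
        ⟪drift g t x, convect (drift g t) (ψ t) x⟫ + ν * ⟪drift g t x, Δ (ψ t) x⟫ +
        ⟪(0 : ℝ → ℝ³ → ℝ³) t x, ψ t x⟫)) =
        ∫ t in Ioo (0 : ℝ) T', ∫ x, (⟪drift g t x, timeDeriv ψ t x⟫ +
        ⟪drift g t x, convect (drift g t) (ψ t) x⟫ + ν * ⟪drift g t x, Δ (ψ t) x⟫ +
        ⟪(0 : ℝ → ℝ³ → ℝ³) t x, ψ t x⟫) := by
      refine setIntegral_eq_of_subset_of_forall_sdiff_eq_zero measurableSet_Ioo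
        (Ioo_subset_Ioo le_rfl hT'1.le) fun t ht => hvan t ?_
      have h1 : ¬ t < T' := fun h => ht.2 ⟨ht.1.1, h⟩
      exact hbT'.trans_le (not_lt.1 h1)
    rw [hI]
    exact hid

end Drift

/-! ## (a) Load-bearing analysis I: finite energy dropped — Type-I rate attained exactly -/

/-- The Type-I amplitude `g_C(t) = C((1−t)^{-1/2} − 1)`: smooth on `(-∞, 1)`, `g_C(0) = 0`,
`√(1−t) g_C(t) = C(1 − √(1−t)) ∈ [0, C]` on `[0, 1)`, `g_C(t) → +∞` as `t ↑ 1` (`C > 0`). -/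
def gI (C : ℝ) (t : ℝ) : ℝ := C * ((Real.sqrt (1 - t))⁻¹ - 1)

theorem gI_zero (C : ℝ) : gI C 0 = 0 := by simp [gI]

theorem sqrt_one_sub_contDiffAt {t : ℝ} (ht : t < 1) :
    ContDiffAt ℝ ∞ (fun s : ℝ => Real.sqrt (1 - s)) t :=
  (Real.contDiffAt_sqrt (sub_pos.2 ht).ne').comp t (contDiffAt_const.sub contDiffAt_id)

theorem gI_contDiffOn (C : ℝ) : ContDiffOn ℝ ∞ (gI C) (Iio 1) := by
  intro t ht
  have h2 : ContDiffAt ℝ ∞ (fun s : ℝ => (Real.sqrt (1 - s))⁻¹) t :=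
    (sqrt_one_sub_contDiffAt ht).inv (Real.sqrt_pos.2 (sub_pos.2 ht)).ne'
  exact (contDiffAt_const.mul (h2.sub contDiffAt_const)).contDiffWithinAt

/-- `√(1−t) · g_C(t) = C (1 − √(1−t))` for `t < 1`. -/
theorem sqrt_mul_gI (C : ℝ) {t : ℝ} (ht : t < 1) :
    Real.sqrt (1 - t) * gI C t = C * (1 - Real.sqrt (1 - t)) := by
  have hs : Real.sqrt (1 - t) ≠ 0 := (Real.sqrt_pos.2 (sub_pos.2 ht)).ne'
  unfold gI
  field_simp

theorem sqrt_one_sub_le_one {t : ℝ} (ht0 : 0 ≤ t) : Real.sqrt (1 - t) ≤ 1 :=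
  calc Real.sqrt (1 - t) ≤ Real.sqrt 1 := Real.sqrt_le_sqrt (by linarith)
    _ = 1 := Real.sqrt_one

theorem gI_nonneg (C : ℝ) (hC : 0 ≤ C) {t : ℝ} (ht0 : 0 ≤ t) (ht : t < 1) : 0 ≤ gI C t := by
  unfold gI
  refine mul_nonneg hC (sub_nonneg.2 ?_)
  exact (one_le_inv₀ (Real.sqrt_pos.2 (sub_pos.2 ht))).2 (sqrt_one_sub_le_one ht0)

/-- The collapse Reynolds number of the Type-I drift: `√(1−t) ‖u(t,x)‖ ≤ C = C √1` on `[0,1)`. -/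
theorem driftI_rate (C : ℝ) (hC : 0 ≤ C) :
    ∀ᶠ t in 𝓝[<] (1 : ℝ), ∀ x : ℝ³,
      Real.sqrt (1 - t) * ‖drift (gI C) t x‖ ≤ C * Real.sqrt 1 := by
  filter_upwards [Ioo_mem_nhdsLT (zero_lt_one' ℝ)] with t ht x
  have hg : 0 ≤ gI C t := gI_nonneg C hC ht.1.le ht.2
  have hs1 := sqrt_one_sub_le_one ht.1.le
  have hs0 : 0 ≤ Real.sqrt (1 - t) := Real.sqrt_nonneg _
  rw [norm_drift, abs_of_nonneg hg, Real.sqrt_one, sqrt_mul_gI C ht.2]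
  nlinarith

/-- `1 − t → 0⁺` as `t ↑ 1`. -/
theorem tendsto_one_sub_nhdsLT :
    Tendsto (fun t : ℝ => 1 - t) (𝓝[<] (1 : ℝ)) (𝓝[>] (0 : ℝ)) := by
  refine tendsto_nhdsWithin_iff.2 ⟨?_, ?_⟩
  · have : Tendsto (fun t : ℝ => 1 - t) (𝓝 (1 : ℝ)) (𝓝 (1 - 1)) :=
      (continuous_const.sub continuous_id).tendsto 1
    simpa using this.mono_left nhdsWithin_le_nhds
  · filter_upwards [self_mem_nhdsWithin] with t ht
    exact sub_pos.2 (show t < 1 from ht)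

/-- `√x → 0⁺` as `x → 0⁺`. -/
theorem tendsto_sqrt_nhdsGT : Tendsto Real.sqrt (𝓝[>] (0 : ℝ)) (𝓝[>] (0 : ℝ)) := by
  have h := Real.continuous_sqrt.continuousWithinAt.tendsto_nhdsWithin
    (s := Ioi (0 : ℝ)) (t := Ioi (0 : ℝ)) (x := 0) (fun x hx => Real.sqrt_pos.2 hx)
  simpa using h

/-- `g_C(t) → +∞` as `t ↑ 1` (`C > 0`). -/
theorem tendsto_gI_atTop (C : ℝ) (hC : 0 < C) : Tendsto (gI C) (𝓝[<] (1 : ℝ)) atTop := by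
  have h3 : Tendsto (fun t : ℝ => (Real.sqrt (1 - t))⁻¹) (𝓝[<] (1 : ℝ)) atTop :=
    tendsto_inv_nhdsGT_zero.comp (tendsto_sqrt_nhdsGT.comp tendsto_one_sub_nhdsLT)
  have h4 : Tendsto (fun t : ℝ => (Real.sqrt (1 - t))⁻¹ + (-1)) (𝓝[<] (1 : ℝ)) atTop :=
    tendsto_atTop_add_const_right _ _ h3
  refine (h4.const_mul_atTop hC).congr' (Eventually.of_forall fun t => ?_)
  simp [gI, sub_eq_add_neg]

theorem tendsto_abs_gI_atTop (C : ℝ) (hC : 0 < C) :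
    Tendsto (fun t => |gI C t|) (𝓝[<] (1 : ℝ)) atTop :=
  tendsto_abs_atTop_atTop.comp (tendsto_gI_atTop C hC)

/-- **Load-bearing (finite energy), all rungs.** For every `C > 0` the rung `X_C` with the
Leray–Hopf hypothesis dropped is FALSE: the Type-I drift `u = g_C(t)e₀`, `p = −g_C′(t)x₀`
(`ν = T = 1`) is classical on `[0,1) × ℝ³` from the datum `0`, has collapse Reynolds number
`≤ C` on all of `[0,1)`, zero vorticity, and no classical extension past `1`. Hence any proof of
any rung — of `RungZero` as much as of the crux — must use the energy class (classically: at the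
step "singular time ⇒ a norm of `ω`/a local scale-invariant quantity blows up", e.g. the
Leray–Giga lower `L^r` rate in the `L^q`-vorticity budget line). [folklore: the `L^∞`
non-uniqueness example `u = g(t)`, `p = −g′·x`] -/
theorem rung_false_without_LerayHopf (C : ℝ) (hC : 0 < C) : ¬ RungWithoutLerayHopf C := by
  intro h
  exact drift_not_hasSmoothExtensionPast (tendsto_abs_gI_atTop C hC) 1
    (h 1 1 one_pos one_pos (drift (gI C)) (driftP (gI C)) (drift_isClassical (gI_contDiffOn C) 1)
      (drift_rapidDecay (gI_zero C)) (driftI_rate C hC.le))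

/-- **Load-bearing (finite energy), the crux verbatim.** `RungReynoldsOne` with the hypothesis
`IsLerayHopfOn T ν 0 (u 0) u` deleted is FALSE (the Type-I drift at `C = 1`). -/
theorem rungReynoldsOne_false_without_LerayHopf : ¬ RungReynoldsOneWithoutLerayHopf := by
  intro h
  refine drift_not_hasSmoothExtensionPast (tendsto_abs_gI_atTop 1 one_pos) 1
    (h 1 1 one_pos one_pos (drift (gI 1)) (driftP (gI 1)) (drift_isClassical (gI_contDiffOn 1) 1)
      (drift_rapidDecay (gI_zero 1)) ?_)
  simpa using driftI_rate 1 zero_le_one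

/-- The LH-free rung at `C = 1` is literally the LH-free crux. -/
theorem rungWithoutLerayHopf_one_iff : RungWithoutLerayHopf 1 ↔ RungReynoldsOneWithoutLerayHopf := by
  simp only [RungWithoutLerayHopf, RungReynoldsOneWithoutLerayHopf, one_mul]

/-! ## (a) Load-bearing analysis II: the energy CLASS, not the weak formulation, is what matters -/

/-- The sub-Type-I amplitude `q_C(t) = C((1−t)^{-1/4} − 1)` (written with nested square roots):
smooth on `(-∞,1)`, `q_C(0) = 0`, `√(1−t) q_C(t) = C(s − s²)`, `s = (1−t)^{1/4} ∈ (0,1]`, so the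
collapse Reynolds number is `≤ C/4` and TENDS TO ZERO; `q_C → +∞`; and `q_C² ≤ C²(1−t)^{-1/2}` is
integrable on `(0,1)` — the drift is locally square integrable in space–time up to `t = 1`. -/
def gQ (C : ℝ) (t : ℝ) : ℝ := C * ((Real.sqrt (Real.sqrt (1 - t)))⁻¹ - 1)

theorem gQ_zero (C : ℝ) : gQ C 0 = 0 := by simp [gQ]

theorem gQ_contDiffOn (C : ℝ) : ContDiffOn ℝ ∞ (gQ C) (Iio 1) := by
  intro t ht
  have hpos : 0 < Real.sqrt (1 - t) := Real.sqrt_pos.2 (sub_pos.2 ht)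
  have h1 : ContDiffAt ℝ ∞ (fun s : ℝ => Real.sqrt (Real.sqrt (1 - s))) t :=
    (Real.contDiffAt_sqrt hpos.ne').comp t (sqrt_one_sub_contDiffAt ht)
  have h2 : ContDiffAt ℝ ∞ (fun s : ℝ => (Real.sqrt (Real.sqrt (1 - s)))⁻¹) t :=
    h1.inv (Real.sqrt_pos.2 hpos).ne'
  exact (contDiffAt_const.mul (h2.sub contDiffAt_const)).contDiffWithinAt

/-- `√(1−t) · q_C(t) = C (s − s·s)` with `s = √(√(1−t))`, for `t < 1`. -/
theorem sqrt_mul_gQ (C : ℝ) {t : ℝ} (ht : t < 1) :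
    Real.sqrt (1 - t) * gQ C t =
      C * (Real.sqrt (Real.sqrt (1 - t)) - Real.sqrt (Real.sqrt (1 - t)) * Real.sqrt (Real.sqrt (1 - t))) := by
  have hpos : 0 < Real.sqrt (1 - t) := Real.sqrt_pos.2 (sub_pos.2 ht)
  unfold gQ
  set s : ℝ := Real.sqrt (Real.sqrt (1 - t)) with hs_def
  have hs0 : s ≠ 0 := (Real.sqrt_pos.2 hpos).ne'
  have hss : Real.sqrt (1 - t) = s * s := (Real.mul_self_sqrt hpos.le).symm
  rw [hss]
  have h1 : s * s⁻¹ = 1 := mul_inv_cancel₀ hs0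
  calc s * s * (C * (s⁻¹ - 1)) = C * (s * (s * s⁻¹) - s * s) := by ring
    _ = C * (s - s * s) := by rw [h1, mul_one]

theorem gQ_nonneg (C : ℝ) (hC : 0 ≤ C) {t : ℝ} (ht0 : 0 ≤ t) (ht : t < 1) : 0 ≤ gQ C t := by
  unfold gQ
  refine mul_nonneg hC (sub_nonneg.2 ?_)
  have hpos : 0 < Real.sqrt (1 - t) := Real.sqrt_pos.2 (sub_pos.2 ht)
  have hle : Real.sqrt (Real.sqrt (1 - t)) ≤ 1 :=
    calc Real.sqrt (Real.sqrt (1 - t)) ≤ Real.sqrt 1 := Real.sqrt_le_sqrt (sqrt_one_sub_le_one ht0)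
      _ = 1 := Real.sqrt_one
  exact (one_le_inv₀ (Real.sqrt_pos.2 hpos)).2 hle

/-- The collapse Reynolds number of the sub-Type-I drift is `≤ C` on `[0, 1)`. -/
theorem driftQ_rate (C : ℝ) (hC : 0 ≤ C) :
    ∀ᶠ t in 𝓝[<] (1 : ℝ), ∀ x : ℝ³,
      Real.sqrt (1 - t) * ‖drift (gQ C) t x‖ ≤ C * Real.sqrt 1 := by
  filter_upwards [Ioo_mem_nhdsLT (zero_lt_one' ℝ)] with t ht x
  have hg : 0 ≤ gQ C t := gQ_nonneg C hC ht.1.le ht.2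
  have hs0 : 0 ≤ Real.sqrt (Real.sqrt (1 - t)) := Real.sqrt_nonneg _
  have hs1 : Real.sqrt (Real.sqrt (1 - t)) ≤ 1 :=
    calc Real.sqrt (Real.sqrt (1 - t)) ≤ Real.sqrt 1 := Real.sqrt_le_sqrt (sqrt_one_sub_le_one ht.1.le)
      _ = 1 := Real.sqrt_one
  rw [norm_drift, abs_of_nonneg hg, Real.sqrt_one, sqrt_mul_gQ C ht.2]
  nlinarith

/-- The collapse Reynolds number of the sub-Type-I drift even TENDS TO ZERO: for every `ε > 0`,
eventually `√(1−t)‖u(t,x)‖ ≤ ε` — one witness sits below every rung of the weak-class ladder. -/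
theorem driftQ_rate_eventually_le (C : ℝ) (hC : 0 ≤ C) {ε : ℝ} (hε : 0 < ε) :
    ∀ᶠ t in 𝓝[<] (1 : ℝ), ∀ x : ℝ³, Real.sqrt (1 - t) * ‖drift (gQ C) t x‖ ≤ ε := by
  have hs : Tendsto (fun t : ℝ => C * Real.sqrt (Real.sqrt (1 - t))) (𝓝[<] (1 : ℝ)) (𝓝 (C * 0)) := by
    refine Tendsto.const_mul C ?_
    have h := (tendsto_sqrt_nhdsGT.comp (tendsto_sqrt_nhdsGT.comp tendsto_one_sub_nhdsLT))
    exact tendsto_nhds_of_tendsto_nhdsWithin h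
  rw [mul_zero] at hs
  filter_upwards [hs.eventually_le_const hε, Ioo_mem_nhdsLT (zero_lt_one' ℝ)] with t ht ht' x
  have hg : 0 ≤ gQ C t := gQ_nonneg C hC ht'.1.le ht'.2
  have hs0 : 0 ≤ Real.sqrt (Real.sqrt (1 - t)) := Real.sqrt_nonneg _
  rw [norm_drift, abs_of_nonneg hg, sqrt_mul_gQ C ht'.2]
  nlinarith

/-- `q_C(t) → +∞` as `t ↑ 1` (`C > 0`). -/
theorem tendsto_gQ_atTop (C : ℝ) (hC : 0 < C) : Tendsto (gQ C) (𝓝[<] (1 : ℝ)) atTop := by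
  have h3 : Tendsto (fun t : ℝ => (Real.sqrt (Real.sqrt (1 - t)))⁻¹) (𝓝[<] (1 : ℝ)) atTop :=
    tendsto_inv_nhdsGT_zero.comp
      (tendsto_sqrt_nhdsGT.comp (tendsto_sqrt_nhdsGT.comp tendsto_one_sub_nhdsLT))
  have h4 : Tendsto (fun t : ℝ => (Real.sqrt (Real.sqrt (1 - t)))⁻¹ + (-1)) (𝓝[<] (1 : ℝ)) atTop :=
    tendsto_atTop_add_const_right _ _ h3
  refine (h4.const_mul_atTop hC).congr' (Eventually.of_forall fun t => ?_)
  simp [gQ, sub_eq_add_neg]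

theorem tendsto_abs_gQ_atTop (C : ℝ) (hC : 0 < C) :
    Tendsto (fun t => |gQ C t|) (𝓝[<] (1 : ℝ)) atTop :=
  tendsto_abs_atTop_atTop.comp (tendsto_gQ_atTop C hC)

/-- `t ↦ (√(1−t))⁻¹ = (1−t)^{-1/2}` is integrable on `(0, 1)`. -/
theorem integrableOn_inv_sqrt_one_sub :
    IntegrableOn (fun t : ℝ => (Real.sqrt (1 - t))⁻¹) (Ioo 0 1) := by
  have h1 : IntervalIntegrable (fun x : ℝ => x ^ (-(1 / 2 : ℝ))) volume 0 1 :=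
    intervalIntegral.intervalIntegrable_rpow' (by norm_num)
  have h2 : IntervalIntegrable (fun x : ℝ => (1 - x) ^ (-(1 / 2 : ℝ))) volume (1 - 0) (1 - 1) :=
    h1.comp_sub_left 1
  rw [sub_zero, sub_self] at h2
  have h3 : IntegrableOn (fun x : ℝ => (1 - x) ^ (-(1 / 2 : ℝ))) (Ioc 0 1) :=
    (intervalIntegrable_iff_integrableOn_Ioc_of_le zero_le_one).1 h2.symm
  refine (h3.mono_set Ioo_subset_Ioc_self).congr_fun (fun t ht => ?_) measurableSet_Ioo
  show (1 - t) ^ (-(1 / 2 : ℝ)) = (Real.sqrt (1 - t))⁻¹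
  rw [Real.rpow_neg (sub_pos.2 ht.2).le, Real.sqrt_eq_rpow]

/-- `q_C²` is integrable on `(0, 1)` (domination by `C² (1−t)^{-1/2}`). -/
theorem integrableOn_gQ_sq (C : ℝ) : IntegrableOn (fun t => gQ C t ^ 2) (Ioo 0 1) := by
  have hdom : IntegrableOn (fun t : ℝ => C ^ 2 * (Real.sqrt (1 - t))⁻¹) (Ioo 0 1) :=
    integrableOn_inv_sqrt_one_sub.const_mul (C ^ 2)
  have hmeas : AEStronglyMeasurable (fun t => gQ C t ^ 2) ((volume : Measure ℝ).restrict (Ioo 0 1)) :=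
    (((gQ_contDiffOn C).continuousOn.mono Ioo_subset_Iio_self).pow 2).aestronglyMeasurable
      measurableSet_Ioo
  refine Integrable.mono' hdom hmeas ?_
  refine (ae_restrict_iff' measurableSet_Ioo).2 (Eventually.of_forall fun t ht => ?_)
  have hpos : 0 < Real.sqrt (1 - t) := Real.sqrt_pos.2 (sub_pos.2 ht.2)
  set s : ℝ := Real.sqrt (Real.sqrt (1 - t)) with hs
  have hspos : 0 < s := Real.sqrt_pos.2 hpos
  have hss : s * s = Real.sqrt (1 - t) := Real.mul_self_sqrt hpos.le
  have hs1 : s ≤ 1 :=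
    calc s ≤ Real.sqrt 1 := Real.sqrt_le_sqrt (sqrt_one_sub_le_one ht.1.le)
      _ = 1 := Real.sqrt_one
  rw [Real.norm_eq_abs, abs_of_nonneg (sq_nonneg _), ← hss]
  -- `(C (1/s − 1))² ≤ C² / (s·s)` because `0 ≤ 1 − s ≤ 1`
  have hq : gQ C t = C * (s⁻¹ - 1) := rfl
  rw [hq, mul_pow, mul_inv, ← sq]
  refine mul_le_mul_of_nonneg_left ?_ (sq_nonneg C)
  rw [sub_sq, inv_pow, mul_one, one_pow]
  have h1 : 0 ≤ s⁻¹ := inv_nonneg.2 hspos.le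
  have h2 : 1 ≤ s⁻¹ := (one_le_inv₀ hspos).2 hs1
  nlinarith [sq_nonneg (s⁻¹ - 1)]

/-- **Load-bearing (energy class versus weak formulation), all rungs.** For every `C > 0` the rung
`X_C` with `IsLerayHopfOn` weakened to the bare weak formulation `IsWeakNSSolutionOn T ν 0 (u 0) u`
is FALSE: the sub-Type-I drift `u = q_C(t)e₀` (`ν = T = 1`) is classical on `[0,1)`, a weak
solution up to `T = 1` (Leray's identity (17) holds against every divergence-free test supported
in `t < 1`; the linear pressure is invisible to divergence-free tests), starts from `0`, has
collapse Reynolds number `≤ C` (indeed `→ 0`), and does not extend. Of the Leray–Hopf clauses it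
violates exactly the ENERGY ones — `energy_bound`, `memLp` (every slice `t > 0` has infinite
energy), weak `L²`-continuity at `t = T`, `strong_initial` — while `weak` holds (this theorem)
and `weakGrad_energy` even holds by Bochner junk (`kineticEnergy` of a non-`L²` slice is `0`).
MESSAGE: the proof of the crux must use `u(t) ∈ L²` quantitatively; distributional NS + interior
smoothness + Schwartz datum + the rate do not suffice, at any constant. -/
theorem rung_false_with_weak_for_LerayHopf (C : ℝ) (hC : 0 < C) : ¬ RungWithWeakForLerayHopf C := by
  intro h
  exact drift_not_hasSmoothExtensionPast (tendsto_abs_gQ_atTop C hC) 1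
    (h 1 1 one_pos one_pos (drift (gQ C)) (driftP (gQ C)) (drift_isClassical (gQ_contDiffOn C) 1)
      (drift_isWeakNSSolutionOn (gQ_contDiffOn C) (integrableOn_gQ_sq C) 1)
      (drift_rapidDecay (gQ_zero C)) (driftQ_rate C hC.le))

/-- **Which Leray–Hopf clause the drifts violate: finite energy of the slices.** A drift slice
with `g t ≠ 0` is a non-zero constant field, hence not in `L²(ℝ³)`; so `IsLerayHopfOn 1 ν 0 (u 0) u`
fails for a drift through its `memLp` field at any such time `t ∈ [0, 1]` (and likewise
`energy_bound`, `strong_initial`), while the weak identity holds (`drift_isWeakNSSolutionOn`). -/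
theorem drift_not_memLp {g : ℝ → ℝ} {t : ℝ} (ht : g t ≠ 0) : ¬ MemLp (drift g t) 2 (volume : Measure ℝ³) := by
  rw [drift_apply, memLp_const_iff (by norm_num) (by norm_num)]
  rintro (h | h)
  · exact (smul_ne_zero ht e₀_ne_zero) h
  · rw [measure_univ_of_isAddLeftInvariant] at h
    exact lt_irrefl _ h

theorem drift_not_isLerayHopfOn {g : ℝ → ℝ} {t : ℝ} (ht0 : 0 ≤ t) (ht1 : t ≤ 1) (ht : g t ≠ 0)
    (ν : ℝ) (u₀ : ℝ³ → ℝ³) : ¬ IsLerayHopfOn 1 ν 0 u₀ (drift g) :=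
  fun h => drift_not_memLp ht (h.memLp t ⟨ht0, ht1⟩)

/-- In particular the sub-Type-I drift of `rung_false_with_weak_for_LerayHopf` is a weak solution
on `[0, 1)` which is NOT Leray–Hopf there (take `t = 3/4`, where `q_C(3/4) = C(√2 − 1) ≠ 0`). -/
theorem driftQ_weak_not_LerayHopf (C : ℝ) (hC : 0 < C) (ν : ℝ) :
    IsWeakNSSolutionOn 1 ν 0 (drift (gQ C) 0) (drift (gQ C)) ∧
      ¬ IsLerayHopfOn 1 ν 0 (drift (gQ C) 0) (drift (gQ C)) := by
  refine ⟨drift_isWeakNSSolutionOn (gQ_contDiffOn C) (integrableOn_gQ_sq C) ν,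
    drift_not_isLerayHopfOn (t := 3 / 4) (by norm_num) (by norm_num) ?_ ν _⟩
  have hpos : 0 < gQ C (3 / 4) := by
    unfold gQ
    refine mul_pos hC (sub_pos.2 ?_)
    have h14 : Real.sqrt (1 - 3 / 4 : ℝ) = 1 / 2 := by
      rw [show (1 - 3 / 4 : ℝ) = (1 / 2) ^ 2 by norm_num, Real.sqrt_sq (by norm_num)]
    rw [h14]
    have hlt : Real.sqrt (1 / 2 : ℝ) < 1 := (Real.sqrt_lt' one_pos).2 (by norm_num)
    have hpos' : 0 < Real.sqrt (1 / 2 : ℝ) := Real.sqrt_pos.2 (by norm_num)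
    exact (one_lt_inv₀ hpos').2 hlt
  exact hpos.ne'

/-! ## (b) Non-vacuity: the rest state is a model of all four hypotheses and of the conclusion -/

/-- The hypotheses of `RungReynoldsOne` are jointly satisfiable, by a model on which the
conclusion holds (rest state `u = 0`, `p = 0`, `ν = T = 1`). -/
theorem rungReynoldsOne_hypotheses_satisfiable :
    ∃ (ν T : ℝ) (u : ℝ → ℝ³ → ℝ³) (p : ℝ → ℝ³ → ℝ), 0 < ν ∧ 0 < T ∧
      IsClassicalNSSolutionOn (Set.Ico 0 T) ν 0 u p ∧ IsLerayHopfOn T ν 0 (u 0) u ∧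
      HasRapidSpatialDecay (u 0) ∧
      (∀ᶠ t in 𝓝[<] T, ∀ x, Real.sqrt (T - t) * ‖u t x‖ ≤ Real.sqrt ν) ∧
      HasSmoothExtensionPast ν 0 u T := by
  refine ⟨1, 1, 0, 0, one_pos, one_pos, isClassicalNSSolutionOn_zero _ _, ?_, ?_, ?_, ?_⟩
  · simpa using (isLerayHopfOn_zero (E := ℝ³) 1 1)
  · simpa [drift_zero (gI_zero 1)] using drift_rapidDecay (gI_zero 1)
  · exact Eventually.of_forall fun t x => by simp
  · exact ⟨2, by norm_num, 0, 0, isClassicalNSSolutionOn_zero _ _, fun _ _ => rfl⟩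

/-- On the rest state the conclusion of the crux holds outright. -/
theorem hasSmoothExtensionPast_rest (ν T : ℝ) :
    HasSmoothExtensionPast ν 0 (0 : ℝ → ℝ³ → ℝ³) T :=
  ⟨T + 1, lt_add_one T, 0, 0, isClassicalNSSolutionOn_zero _ _, fun _ _ => rfl⟩


/-! ## (d) Logical position of the crux inside the ladder (bookkeeping, for orientation) -/

/-- The honest rung `X_C` (with the Leray–Hopf hypothesis): the antecedent shape of `LadderGlue`
and `Assembly` in the route file. -/
def Rung (C : ℝ) : Prop :=
  ∀ (ν T : ℝ), 0 < ν → 0 < T → ∀ (u : ℝ → ℝ³ → ℝ³) (p : ℝ → ℝ³ → ℝ),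
    IsClassicalNSSolutionOn (Set.Ico 0 T) ν 0 u p → IsLerayHopfOn T ν 0 (u 0) u →
    HasRapidSpatialDecay (u 0) →
    (∀ᶠ t in 𝓝[<] T, ∀ x, Real.sqrt (T - t) * ‖u t x‖ ≤ C * Real.sqrt ν) →
    HasSmoothExtensionPast ν 0 u T

/-- The crux is literally rung one. -/
theorem rungReynoldsOne_iff_rung_one : RungReynoldsOne ↔ Rung 1 := by
  simp only [RungReynoldsOne, Rung, one_mul]

/-- The ladder is monotone: a higher rung implies every lower one. -/
theorem rung_mono {C C' : ℝ} (hCC' : C ≤ C') (h : Rung C') : Rung C := by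
  intro ν T hν hT u p hcl hLH hdec hrate
  refine h ν T hν hT u p hcl hLH hdec ?_
  filter_upwards [hrate] with t ht x
  exact (ht x).trans (mul_le_mul_of_nonneg_right hCC' (Real.sqrt_nonneg ν))

/-- A collapse-Reynolds-number bound is a Type-I rate (`IsTypeIBlowup` with constant `C√ν`). -/
theorem isTypeIBlowup_of_rate {C ν T : ℝ} {u : ℝ → ℝ³ → ℝ³}
    (h : ∀ᶠ t in 𝓝[<] T, ∀ x, Real.sqrt (T - t) * ‖u t x‖ ≤ C * Real.sqrt ν) :
    IsTypeIBlowup u T := by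
  refine ⟨C * Real.sqrt ν, ?_⟩
  filter_upwards [h, self_mem_nhdsWithin] with t ht ht' x
  have hpos : 0 < Real.sqrt (T - t) := Real.sqrt_pos.2 (sub_pos.2 ht')
  rw [le_div_iff₀ hpos, mul_comm]
  exact ht x

/-- Every rung — in particular the crux — follows from the route's target `NoTypeIBlowup`
(stmt-1217); the ladder is a monotone exhaustion of it (`LadderGlue` is the converse direction). -/
theorem rung_of_noTypeIBlowup (hX : NoTypeIBlowup) (C : ℝ) : Rung C :=
  fun ν T hν hT u p hcl hLH hdec hrate => hX ν T hν hT u p hcl hLH hdec (isTypeIBlowup_of_rate hrate)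

theorem rungReynoldsOne_of_noTypeIBlowup (hX : NoTypeIBlowup) : RungReynoldsOne :=
  rungReynoldsOne_iff_rung_one.2 (rung_of_noTypeIBlowup hX 1)

/-- **What a refutation of the crux is**: a maximal classical solution (`IsMaximalSmoothSolution`:
classical on `[0,T)`, no classical extension) which is Leray–Hopf from a rapidly decaying datum
and blows up at `T` with collapse Reynolds number `≤ 1` — a finite-energy Type-I singularity of
the Navier–Stokes equations (hence `¬ NoTypeIBlowup`, hence not Clay (A)). -/
theorem not_rungReynoldsOne_iff :
    ¬ RungReynoldsOne ↔ ∃ (ν T : ℝ) (u : ℝ → ℝ³ → ℝ³) (p : ℝ → ℝ³ → ℝ), 0 < ν ∧ 0 < T ∧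
      IsMaximalSmoothSolution ν 0 u p T ∧ IsLerayHopfOn T ν 0 (u 0) u ∧
      HasRapidSpatialDecay (u 0) ∧
      (∀ᶠ t in 𝓝[<] T, ∀ x, Real.sqrt (T - t) * ‖u t x‖ ≤ Real.sqrt ν) := by
  constructor
  · intro h
    by_contra hne
    apply h
    intro ν T hν hT u p hcl hLH hdec hrate
    by_contra hext
    exact hne ⟨ν, T, u, p, hν, hT, ⟨hcl, hext⟩, hLH, hdec, hrate⟩
  · rintro ⟨ν, T, u, p, hν, hT, ⟨hcl, hext⟩, hLH, hdec, hrate⟩ h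
    exact hext (h ν T hν hT u p hcl hLH hdec hrate)

theorem isTypeIBlowup_of_not_rungReynoldsOne (h : ¬ RungReynoldsOne) :
    ∃ (ν T : ℝ) (u : ℝ → ℝ³ → ℝ³) (p : ℝ → ℝ³ → ℝ), 0 < ν ∧ 0 < T ∧
      IsMaximalSmoothSolution ν 0 u p T ∧ IsLerayHopfOn T ν 0 (u 0) u ∧
      HasRapidSpatialDecay (u 0) ∧ IsTypeIBlowup u T := by
  obtain ⟨ν, T, u, p, hν, hT, hmax, hLH, hdec, hrate⟩ := not_rungReynoldsOne_iff.1 h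
  refine ⟨ν, T, u, p, hν, hT, hmax, hLH, hdec, isTypeIBlowup_of_rate (C := 1) (ν := ν) ?_⟩
  simpa using hrate

/-! ## (e) Robustness of the rate hypothesis to its filter (no `Real.sqrt` junk to exploit) -/

/-- The rate hypothesis is insensitive to replacing `𝓝[<] T` by the full `𝓝 T`: for `t ≥ T`,
`√(T−t) = 0` and the inequality is `0 ≤ √ν`. So no refutation hides in the junk values of
`Real.sqrt` on negatives, and a prover may use either filter. -/
theorem rate_nhds_iff {ν T : ℝ} {u : ℝ → ℝ³ → ℝ³} :
    (∀ᶠ t in 𝓝 T, ∀ x, Real.sqrt (T - t) * ‖u t x‖ ≤ Real.sqrt ν) ↔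
      (∀ᶠ t in 𝓝[<] T, ∀ x, Real.sqrt (T - t) * ‖u t x‖ ≤ Real.sqrt ν) := by
  constructor
  · exact fun h => h.filter_mono nhdsWithin_le_nhds
  · intro h
    rw [← nhdsLT_sup_nhdsGE, eventually_sup]
    refine ⟨h, ?_⟩
    filter_upwards [self_mem_nhdsWithin] with t ht x
    have : Real.sqrt (T - t) = 0 := Real.sqrt_eq_zero'.2 (sub_nonpos.2 ht)
    rw [this, zero_mul]
    exact Real.sqrt_nonneg ν

/-! ## (f) Positive calibration: the crux is an a-priori `L^∞` bound (continuation is in the tree) -/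

/-- **Reduction of the crux to an a-priori bound.** By the tree theorem
`hasSmoothExtensionPast_of_bounded_holds` (Robinson–Rodrigo–Sadowski 2016 Thm 8.17: bounded
classical Leray–Hopf solutions continue), `RungReynoldsOne` follows from — and is morally
equivalent to — the statement that a rate-one solution stays bounded on `[0, T) × ℝ³`. The
witnesses of part (a) show that this continuation step is ALSO where the energy class enters:
for the drifts `HasSmoothExtensionPast` fails although nothing but boundedness is lost. -/
theorem rungReynoldsOne_of_apriori_bound
    (H : ∀ (ν T : ℝ), 0 < ν → 0 < T → ∀ (u : ℝ → ℝ³ → ℝ³) (p : ℝ → ℝ³ → ℝ),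
      IsClassicalNSSolutionOn (Set.Ico 0 T) ν 0 u p → IsLerayHopfOn T ν 0 (u 0) u →
      HasRapidSpatialDecay (u 0) →
      (∀ᶠ t in 𝓝[<] T, ∀ x, Real.sqrt (T - t) * ‖u t x‖ ≤ Real.sqrt ν) →
      ∃ M : ℝ, ∀ t ∈ Ico 0 T, ∀ x, ‖u t x‖ ≤ M) :
    RungReynoldsOne :=
  fun ν T hν hT u p hcl hLH hdec hrate =>
    hasSmoothExtensionPast_of_bounded_holds hν hT hcl hLH (H ν T hν hT u p hcl hLH hdec hrate)

/-- Bookkeeping for the a-priori bound: a bound EVENTUALLY near `T` plus bounds on every closed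
sub-strip `[0, T'] × ℝ³`, `T' < T`, give the bound on `[0, T) × ℝ³` that
`rungReynoldsOne_of_apriori_bound` consumes (so the research content of the crux is the eventual
bound near `T`; the sub-strip bounds are far-field regularity of Schwartz-datum solutions). -/
theorem bound_of_eventually_of_substrips {T : ℝ} {u : ℝ → ℝ³ → ℝ³}
    (h₁ : ∃ M : ℝ, ∀ᶠ t in 𝓝[<] T, ∀ x, ‖u t x‖ ≤ M)
    (h₂ : ∀ T' < T, ∃ M : ℝ, ∀ t ∈ Icc 0 T', ∀ x, ‖u t x‖ ≤ M) :
    ∃ M : ℝ, ∀ t ∈ Ico 0 T, ∀ x, ‖u t x‖ ≤ M := by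
  obtain ⟨M₁, hM₁⟩ := h₁
  obtain ⟨δ, hδ, hball⟩ : ∃ δ > 0, ∀ t, T - δ < t → t < T → ∀ x, ‖u t x‖ ≤ M₁ := by
    rcases (mem_nhdsLT_iff_exists_Ioo_subset).1 hM₁ with ⟨l, hl, hsub⟩
    exact ⟨T - l, sub_pos.2 hl, fun t ht1 ht2 x => hsub ⟨by linarith, ht2⟩ x⟩
  obtain ⟨M₂, hM₂⟩ := h₂ (T - δ) (by linarith)
  refine ⟨max M₁ M₂, fun t ht x => ?_⟩
  rcases lt_or_ge (T - δ) t with h | h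
  · exact (hball t h ht.2 x).trans (le_max_left _ _)
  · exact (hM₂ t ⟨ht.1, h⟩ x).trans (le_max_right _ _)

/-! ## (c) Natural strengthenings of the METHOD refuted: window and ceiling of the `L^q`-vorticity
budget (crux idea card `Ideas/ideas-2882-ideator3.md`, card 1; planner note RUNG_NOTE on 1217)

The card-1 bookkeeping closes rung `X_C` as soon as some `q > 3/2` (in practice `2 ≤ q < 3`)
satisfies the exponent inequality `q(q−1)C²/4 < q − 3/2` (upper Grönwall exponent from
`d/dt‖ω‖_q^q ≤ q(q−1)‖u‖_∞²‖ω‖_q^q/(4ν)` against the lower exponent forced by the Leray–Giga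
`L^r` rate, `r = 3q/(3−q)`). The real-arithmetic content — which rungs this can EVER reach — is
settled here exactly: at `C = 1` the admissible window is precisely `2 < q < 3` (so the enstrophy
budget `q = 2` is exactly borderline at the crux and reaches exactly the rungs `C < 1`), and over
all `q > 1` the certifiable constants are exactly `C² < 8 − 4√3`, i.e. `C < √6 − √2 ∈
(1.035, 1.036)`, the ceiling being attained only at `q* = (3+√3)/2`. Consequence for the ladder:
this bookkeeping can certify the crux (`C = 1`) but NO rung `C ≥ 1.036` — rungs `2, 5, 10` of the
tenure plan need the certificate machinery or a new idea. (These lemmas say nothing about the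
analytic validity of the budget; they bound what it can yield if valid.) -/

/-- The exponent inequality of the card-1 bookkeeping at rung `C` and Lebesgue exponent `q`. -/
def BudgetCloses (C q : ℝ) : Prop := q * (q - 1) * C ^ 2 / 4 < q - 3 / 2

/-- At the crux `C = 1` the budget closes exactly for `2 < q < 3`. -/
theorem budgetCloses_one_iff (q : ℝ) : BudgetCloses 1 q ↔ 2 < q ∧ q < 3 := by
  unfold BudgetCloses
  constructor
  · intro h
    have h' : (q - 2) * (q - 3) < 0 := by nlinarith
    constructor
    · by_contra h2
      have h2' : q ≤ 2 := not_lt.1 h2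
      nlinarith [mul_nonneg_of_nonpos_of_nonpos (sub_nonpos.2 h2') (by linarith : q - 3 ≤ 0)]
    · by_contra h3
      have h3' : 3 ≤ q := not_lt.1 h3
      nlinarith [mul_nonneg (by linarith : 0 ≤ q - 2) (sub_nonneg.2 h3')]
  · rintro ⟨h2, h3⟩
    nlinarith [mul_pos (sub_pos.2 h2) (sub_pos.2 h3)]

/-- The enstrophy budget (`q = 2`) closes exactly the rungs `C < 1` (planner RUNG_NOTE: "X_C for
every C < 1 is a two-line enstrophy-Grönwall × Leray-rate argument"); the crux sits exactly on
its boundary. -/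
theorem budgetCloses_two_iff {C : ℝ} (hC : 0 ≤ C) : BudgetCloses C 2 ↔ C < 1 := by
  unfold BudgetCloses
  constructor
  · intro h
    by_contra h1
    have h1' : 1 ≤ C := not_lt.1 h1
    nlinarith [mul_le_mul h1' h1' zero_le_one hC]
  · intro h
    nlinarith [mul_lt_mul'' h h hC hC]

/-- **Ceiling of the method.** For every `q > 1`, `4(q − 3/2)/(q(q−1)) ≤ 8 − 4√3`; hence if the
budget closes at rung `C` for some `q > 1` then `C² < 8 − 4√3`. -/
theorem budget_ratio_le (q : ℝ) (hq : 1 < q) :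
    4 * (q - 3 / 2) / (q * (q - 1)) ≤ 8 - 4 * Real.sqrt 3 := by
  set s : ℝ := Real.sqrt 3 with hs
  have hs3 : s ^ 2 = 3 := Real.sq_sqrt (by norm_num)
  have hs0 : 0 ≤ s := Real.sqrt_nonneg 3
  have hs2 : s < 2 := by
    have h4 : Real.sqrt 4 = 2 := by
      rw [show (4 : ℝ) = 2 ^ 2 by norm_num, Real.sqrt_sq (by norm_num)]
    rw [hs, ← h4]
    exact Real.sqrt_lt_sqrt (by norm_num) (by norm_num)
  have hqq : 0 < q * (q - 1) := mul_pos (by linarith) (by linarith)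
  rw [div_le_iff₀ hqq]
  have key : (4 - 2 * s) * ((8 - 4 * s) * (q * (q - 1)) - 4 * (q - 3 / 2)) =
      2 * ((4 - 2 * s) * q - (3 - s)) ^ 2 := by
    linear_combination (-2) * hs3
  have h42 : 0 < 4 - 2 * s := by linarith
  have hnonneg : 0 ≤ (8 - 4 * s) * (q * (q - 1)) - 4 * (q - 3 / 2) := by
    have h2 : 0 ≤ (4 - 2 * s) * ((8 - 4 * s) * (q * (q - 1)) - 4 * (q - 3 / 2)) := by
      rw [key]; positivity
    exact nonneg_of_mul_nonneg_right (by simpa [mul_comm] using h2) h42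
  linarith

theorem sq_lt_of_budgetCloses {C q : ℝ} (hq : 1 < q) (h : BudgetCloses C q) :
    C ^ 2 < 8 - 4 * Real.sqrt 3 := by
  have hqq : 0 < q * (q - 1) := mul_pos (by linarith) (by linarith)
  have h1 : C ^ 2 < 4 * (q - 3 / 2) / (q * (q - 1)) := by
    rw [lt_div_iff₀ hqq]
    unfold BudgetCloses at h
    nlinarith
  exact h1.trans_le (budget_ratio_le q hq)

/-- The ceiling is attained at `q* = (3 + √3)/2`. -/
theorem budget_ratio_at_qstar :
    4 * ((3 + Real.sqrt 3) / 2 - 3 / 2) / ((3 + Real.sqrt 3) / 2 * ((3 + Real.sqrt 3) / 2 - 1)) =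
      8 - 4 * Real.sqrt 3 := by
  set s : ℝ := Real.sqrt 3 with hs
  have hs3 : s ^ 2 = 3 := Real.sq_sqrt (by norm_num)
  have hs0 : 0 ≤ s := Real.sqrt_nonneg 3
  have hden : 0 < (3 + s) / 2 * ((3 + s) / 2 - 1) := mul_pos (by linarith) (by linarith)
  rw [div_eq_iff hden.ne']
  linear_combination (s + 2) * hs3

/-- `(√6 − √2)² = 8 − 4√3`: the ceiling constant is `√6 − √2`. -/
theorem sqrt_six_sub_sqrt_two_sq : (Real.sqrt 6 - Real.sqrt 2) ^ 2 = 8 - 4 * Real.sqrt 3 := by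
  have h6 : Real.sqrt 6 ^ 2 = 6 := Real.sq_sqrt (by norm_num)
  have h2 : Real.sqrt 2 ^ 2 = 2 := Real.sq_sqrt (by norm_num)
  have hab : Real.sqrt 6 * Real.sqrt 2 = 2 * Real.sqrt 3 := by
    rw [← Real.sqrt_mul (by norm_num) 2, show ((6 : ℝ) * 2) = (2 : ℝ) ^ 2 * 3 by norm_num,
      Real.sqrt_mul (by norm_num) 3, Real.sqrt_sq (by norm_num)]
  linear_combination h6 + h2 - 2 * hab

/-- Numerical bracket of the ceiling: `1.035 < √6 − √2 < 1.036` (so the crux `C = 1` is inside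
the window with a 3.5 % margin, and rung `C = 1.036` is already outside). -/
theorem sqrt_six_sub_sqrt_two_bounds :
    (1.035 : ℝ) < Real.sqrt 6 - Real.sqrt 2 ∧ Real.sqrt 6 - Real.sqrt 2 < 1.036 := by
  have h6l : (2.44948 : ℝ) < Real.sqrt 6 := (Real.lt_sqrt (by norm_num)).2 (by norm_num)
  have h6u : Real.sqrt 6 < (2.4495 : ℝ) := (Real.sqrt_lt' (by norm_num)).2 (by norm_num)
  have h2l : (1.41421 : ℝ) < Real.sqrt 2 := (Real.lt_sqrt (by norm_num)).2 (by norm_num)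
  have h2u : Real.sqrt 2 < (1.41422 : ℝ) := (Real.sqrt_lt' (by norm_num)).2 (by norm_num)
  constructor <;> linarith

/-- **Corollary (reach of the method).** If the card-1 budget closes at rung `C` for some
`q > 1`, then `C < √6 − √2 < 1.036`. -/
theorem lt_ceiling_of_budgetCloses {C q : ℝ} (hq : 1 < q) (h : BudgetCloses C q) :
    C < Real.sqrt 6 - Real.sqrt 2 := by
  have h1 := sq_lt_of_budgetCloses hq h
  rw [← sqrt_six_sub_sqrt_two_sq] at h1
  have hpos : 0 < Real.sqrt 6 - Real.sqrt 2 := by linarith [sqrt_six_sub_sqrt_two_bounds.1]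
  exact lt_of_pow_lt_pow_left₀ 2 hpos.le h1

/-- The crux is inside the window: the budget closes at `C = 1` for `q* = (3+√3)/2` (indeed for
every `q ∈ (2,3)`), with exponents `q*(q*−1)/4 = (3+2√3)/8 ≈ 0.808 < √3/2 ≈ 0.866 = q* − 3/2`. -/
theorem budgetCloses_one_qstar : BudgetCloses 1 ((3 + Real.sqrt 3) / 2) := by
  rw [budgetCloses_one_iff]
  have h3l : (1.7 : ℝ) < Real.sqrt 3 := (Real.lt_sqrt (by norm_num)).2 (by norm_num)
  have h3u : Real.sqrt 3 < (1.8 : ℝ) := (Real.sqrt_lt' (by norm_num)).2 (by norm_num)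
  constructor <;> linarith


/-- **Tightness of the enstrophy budget at the crux.** The model enstrophy `E(t) = (1−t)^{-1/2}`
satisfies the `q = 2`, `C = 1` Grönwall inequality `E′ ≤ C²E/(2(T−t))` WITH EQUALITY and at the
same time realises Leray's lower `H¹`-rate `E ≥ c (T−t)^{-1/2}` with equality: at `C = 1` the
enstrophy budget and the lower rate are compatible forever, so the `q = 2` argument proves nothing
at the crux without an extra input (the deficit/rigidity step of the planner's RUNG_NOTE, or
`q > 2`). -/
theorem enstrophy_budget_saturated {t : ℝ} (ht : t < 1) :
    HasDerivAt (fun s : ℝ => (Real.sqrt (1 - s))⁻¹)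
      ((1 : ℝ) ^ 2 * (Real.sqrt (1 - t))⁻¹ / (2 * (1 - t))) t := by
  have h1t : 0 < 1 - t := sub_pos.2 ht
  have hs : 0 < Real.sqrt (1 - t) := Real.sqrt_pos.2 h1t
  have h1 : HasDerivAt (fun s : ℝ => 1 - s) (-1) t := by
    have h := (hasDerivAt_id t).const_sub (1 : ℝ)
    simpa using h
  have h2 : HasDerivAt (fun s : ℝ => Real.sqrt (1 - s)) (1 / (2 * Real.sqrt (1 - t)) * (-1)) t :=
    (Real.hasDerivAt_sqrt h1t.ne').comp t h1
  have h3 := h2.inv hs.ne'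
  refine h3.congr_deriv ?_
  have hss : Real.sqrt (1 - t) ^ 2 = 1 - t := Real.sq_sqrt h1t.le
  field_simp
  rw [hss]

/-! ## (a) Load-bearing analysis III (typing remark): the classical hypothesis protects the
pointwise agreement clause of `HasSmoothExtensionPast` -/

/-- The crux with the classical hypothesis `IsClassicalNSSolutionOn (Ico 0 T) ν 0 u p` deleted
(and with it the pressure, which occurs nowhere else). False (`rungReynoldsOne_false_without_classical`),
but only at junk level. -/
def RungReynoldsOneWithoutClassical : Prop :=
  ∀ (ν T : ℝ), 0 < ν → 0 < T → ∀ (u : ℝ → ℝ³ → ℝ³),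
    IsLerayHopfOn T ν 0 (u 0) u → HasRapidSpatialDecay (u 0) →
    (∀ᶠ t in 𝓝[<] T, ∀ x, Real.sqrt (T - t) * ‖u t x‖ ≤ Real.sqrt ν) →
    HasSmoothExtensionPast ν 0 u T

open Classical in
/-- The spike: the rest state modified at the single space–time point `(1/2, 0)`. -/
def spike : ℝ → ℝ³ → ℝ³ := fun t x => if t = 1 / 2 ∧ x = 0 then e₀ else 0

theorem spike_of_ne {t : ℝ} (ht : t ≠ 1 / 2) : spike t = 0 := by
  funext x
  show (if t = 1 / 2 ∧ x = 0 then e₀ else 0) = 0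
  rw [if_neg fun h => ht h.1]

theorem spike_zero : spike 0 = 0 := spike_of_ne (by norm_num)

theorem spike_half_zero : spike (1 / 2) 0 = e₀ := by
  show (if (1 / 2 : ℝ) = 1 / 2 ∧ (0 : ℝ³) = 0 then e₀ else 0) = e₀
  rw [if_pos ⟨rfl, rfl⟩]

theorem spike_half_of_ne {x : ℝ³} (hx : x ≠ 0) : spike (1 / 2) x = 0 := by
  show (if (1 / 2 : ℝ) = 1 / 2 ∧ x = 0 then e₀ else 0) = 0
  rw [if_neg fun h => hx h.2]

/-- The spike vanishes at every point other than `(1/2, 0)`. -/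
theorem spike_eq_zero_of_ne {t : ℝ} {x : ℝ³} (h : (t, x) ≠ ((1 / 2 : ℝ), (0 : ℝ³))) : spike t x = 0 := by
  by_cases ht : t = 1 / 2
  · subst ht
    exact spike_half_of_ne fun hx => h (by rw [hx])
  · rw [spike_of_ne ht]
    rfl

/-- Every slice of the spike vanishes almost everywhere. -/
theorem spike_ae_zero (t : ℝ) : spike t =ᵐ[volume] (0 : ℝ³ → ℝ³) := by
  have h : ∀ᵐ x ∂(volume : Measure ℝ³), x ≠ (0 : ℝ³) :=
    compl_mem_ae_iff.2 (measure_singleton (0 : ℝ³))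
  filter_upwards [h] with x hx
  exact spike_eq_zero_of_ne fun h' => hx (congrArg Prod.snd h')

/-- The spike vanishes almost everywhere in space–time. -/
theorem spike_ae_zero_prod : ∀ᵐ z ∂(volume : Measure (ℝ × ℝ³)), uncurry spike z = 0 := by
  have h : ∀ᵐ z ∂(volume : Measure (ℝ × ℝ³)), z ≠ ((1 / 2 : ℝ), (0 : ℝ³)) := by
    rw [Measure.volume_eq_prod]
    exact compl_mem_ae_iff.2 (measure_singleton _)
  filter_upwards [h] with z hz
  exact spike_eq_zero_of_ne hz

/-- Off the single time `t = 1/2` the spike is the rest state (an a.e. statement in time). -/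
theorem spike_ae_time_zero (μ : Measure ℝ) [NullSingletonClass μ] :
    ∀ᵐ t ∂μ, spike t = 0 := by
  have h : ∀ᵐ t ∂μ, t ≠ (1 / 2 : ℝ) := compl_mem_ae_iff.2 (measure_singleton _)
  filter_upwards [h] with t ht
  exact spike_of_ne ht

theorem integral_inner_spike (t : ℝ) (w : ℝ³ → ℝ³) : ∫ x, ⟪spike t x, w x⟫_ℝ = 0 := by
  refine integral_eq_zero_of_ae ?_
  filter_upwards [spike_ae_zero t] with x hx
  simp [hx]

theorem kineticEnergy_spike (t : ℝ) : VectorCalculus.kineticEnergy (spike t) = 0 := by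
  unfold VectorCalculus.kineticEnergy
  rw [integral_eq_zero_of_ae, mul_zero]
  filter_upwards [spike_ae_zero t] with x hx
  simp [hx]

theorem eLpNorm_spike (t : ℝ) : eLpNorm (spike t) 2 volume = 0 := by
  rw [eLpNorm_congr_ae (spike_ae_zero t), eLpNorm_zero]

/-- **The spike is a Leray–Hopf solution** of the unforced system on `[0, 1)` from the datum `0`,
for every viscosity: every clause of `IsLerayHopfOn` is an integral identity, an a.e. statement,
or a bound on integrals, none of which sees a null set. -/
theorem spike_isLerayHopfOn (ν : ℝ) : IsLerayHopfOn 1 ν 0 (spike 0) spike where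
  weak := by
    refine ⟨?_, ?_, ?_, ?_⟩
    · -- a.e. equal to the (measurable) zero field
      have hae : (uncurry spike) =ᵐ[(volume : Measure (ℝ × ℝ³)).restrict (Ioo 0 1 ×ˢ univ)]
          fun _ => (0 : ℝ³) :=
        ae_restrict_of_ae (spike_ae_zero_prod.mono fun z hz => hz)
      exact aestronglyMeasurable_const.congr hae.symm
    · intro K _
      have hae : ∀ᵐ z ∂(volume : Measure (ℝ × ℝ³)).restrict (Ioo 0 1 ×ˢ K),
          ‖uncurry spike z‖ₑ ^ 2 = (0 : ℝ≥0∞) :=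
        ae_restrict_of_ae (spike_ae_zero_prod.mono fun z hz => by simp [hz])
      rw [lintegral_congr_ae hae]
      simp
    · exact ae_of_all _ fun t θ _ => integral_inner_spike t _
    · intro ψ _ _
      have hin : ∀ t ∈ Ioo (0 : ℝ) 1, (∫ x, (⟪spike t x, timeDeriv ψ t x⟫_ℝ +
          ⟪spike t x, convect (spike t) (ψ t) x⟫_ℝ +
          ν * ⟪spike t x, Δ (ψ t) x⟫_ℝ + ⟪(0 : ℝ → ℝ³ → ℝ³) t x, ψ t x⟫_ℝ)) = 0 := by
        intro t _
        refine integral_eq_zero_of_ae ?_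
        filter_upwards [spike_ae_zero t] with x hx
        simp [hx]
      rw [setIntegral_congr_fun measurableSet_Ioo hin, integral_inner_spike 0]
      simp
  energy_bound := by
    refine ⟨0, ae_of_all _ fun t => ?_⟩
    have : eEnergy (spike t) = 0 := by
      unfold eEnergy
      rw [lintegral_congr_ae ((spike_ae_zero t).mono fun x hx => by rw [hx]), ]
      simp
    simp [this]
  memLp := fun t _ => (MemLp.zero).ae_eq (spike_ae_zero t).symm
  weakGrad_energy := by
    refine ⟨fun _ _ => 0, ?_, by simp, fun t _ => ?_, ae_of_all _ fun s t _ => ?_⟩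
    · filter_upwards [spike_ae_time_zero ((volume : Measure ℝ).restrict (Ioo 0 1))] with t ht
      rw [ht]
      simpa using (hasWeakGradient_zero (E := ℝ³))
    · simp [kineticEnergy_spike]
    · simp [kineticEnergy_spike]
  weak_continuous := fun w _ => by
    have h : (fun t => ∫ x, ⟪spike t x, w x⟫_ℝ) = fun _ => 0 := funext fun t => integral_inner_spike t w
    rw [h, integral_inner_spike 0 w]
    exact ⟨continuousOn_const, tendsto_const_nhds⟩
  strong_initial := by
    have h : (fun t => eLpNorm (spike t - spike 0) 2 volume) = fun _ => 0 := by
      funext t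
      rw [spike_zero, sub_zero, eLpNorm_spike]
    rw [h]
    exact tendsto_const_nhds

/-- The spike slice at `t = 1/2` is discontinuous at the origin, so the spike has no classical
continuation (which would have to reproduce that slice pointwise). -/
theorem spike_not_hasSmoothExtensionPast (ν : ℝ) : ¬ HasSmoothExtensionPast ν 0 spike 1 := by
  rintro ⟨T', hT', u', p', hcl, hagree⟩
  have hmem : (1 / 2 : ℝ) ∈ Ico (0 : ℝ) 1 := ⟨by norm_num, by norm_num⟩
  have hcont : Continuous (u' (1 / 2)) :=
    (hcl.contDiff_velocity (t := 1 / 2) ⟨by norm_num, by linarith⟩).continuous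
  have heq : u' (1 / 2) = spike (1 / 2) := hagree _ hmem
  -- the sequence `xₙ = (n+1)⁻¹ e₀ → 0` avoids the origin
  set xs : ℕ → ℝ³ := fun n => (1 / ((n : ℝ) + 1)) • e₀ with hxs
  have hxs0 : Tendsto xs atTop (𝓝 0) := by
    have := (tendsto_one_div_add_atTop_nhds_zero_nat (𝕜 := ℝ)).smul_const e₀
    simpa [hxs] using this
  have hne : ∀ n, xs n ≠ 0 := fun n => by
    have h1 : (1 / ((n : ℝ) + 1)) ≠ 0 := by positivity
    exact smul_ne_zero h1 e₀_ne_zero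
  have h1 : Tendsto (fun n => u' (1 / 2) (xs n)) atTop (𝓝 (u' (1 / 2) 0)) :=
    (hcont.tendsto 0).comp hxs0
  have h2 : (fun n => u' (1 / 2) (xs n)) = fun _ => 0 := by
    funext n
    rw [heq, spike_half_of_ne (hne n)]
  rw [h2, heq, spike_half_zero] at h1
  exact e₀_ne_zero (tendsto_nhds_unique tendsto_const_nhds h1).symm

/-- The zero field is rapidly decaying. -/
theorem hasRapidSpatialDecay_zero : HasRapidSpatialDecay (0 : ℝ³ → ℝ³) := by
  intro n K
  refine ⟨0, fun x => ?_⟩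
  have h : (0 : ℝ³ → ℝ³) = fun _ => (0 : ℝ³) := rfl
  rw [h, iteratedFDeriv_fun_zero]
  simp

/-- **Load-bearing (classical hypothesis), junk level.** With `IsClassicalNSSolutionOn` deleted the
crux is FALSE: the spike is Leray–Hopf from the zero datum, has collapse Reynolds number `0` near
`T = 1`, and admits no classical continuation. This says only that the conclusion's agreement
clause `u' t = u t` is POINTWISE, protected in the crux by the smoothness of `u`; a weak-solution
restatement of any rung must conclude with a.e. agreement. The informative open direction (a
genuinely singular Leray–Hopf solution obeying the rate) is untouched. -/
theorem rungReynoldsOne_false_without_classical : ¬ RungReynoldsOneWithoutClassical := by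
  intro h
  refine spike_not_hasSmoothExtensionPast 1 (h 1 1 one_pos one_pos spike (spike_isLerayHopfOn 1) ?_ ?_)
  · rw [spike_zero]
    exact hasRapidSpatialDecay_zero
  · filter_upwards [Ioo_mem_nhdsLT (show (1 / 2 : ℝ) < 1 by norm_num)] with t ht x
    rw [spike_of_ne (ne_of_gt ht.1)]
    simp

end Summit.NavierStokesRegularity.NavierStokesRegularity.Cruxes.RungReynoldsOne.Disproof

end
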